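import Literature.MathematicalPhysics.QuantumFieldTheory.Balaban1983to89.DagDischargedII
import Literature.MathematicalPhysics.QuantumFieldTheory.Balaban1983to89.B15Eq06Resum
import Literature.MathematicalPhysics.QuantumFieldTheory.Balaban1983to89.B15Claim189Assembly
import Literature.MathematicalPhysics.QuantumFieldTheory.Balaban1983to89.B15Norm1102Object

/-!
# `Balaban1983to89.B15LeafKnit` — [Balaban1989LargeFieldI] T. Bałaban, *Large field renormalization. I. The basic step of
# the 𝐑 operation*, Commun. Math. Phys. **122** (1989) 175–202: the DAG leaf `rBasicStep` = `DagBinding.B15Leaf W` KNITTED BY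
# NAME from the tree's concrete objects, and the DAG node N12 `Dag.B15_main (leavesP w P)` at every run pinning `W` to the knit

statement-level skeleton of published theorems with citation tags; proofs where landed; nothing here is a claim about
the Yang–Mills mass gap.

TRACK-A KNIT MODULE (HUMAN RULING D-0062; seat `pub-ymgap-dag-n12-a`, -a = KNIT-BY-NAME for node N12; YM-PLAN v0.12.15 §2b row
N12; chair R429; `bears_on: R4∕N12`).  PDF held `paper:balaban1989-cmp122-large-field-i` (journal page = PDF page + 174).

THE NODE.  `Dag.B15_main ℓ := ℓ.b5 → ℓ.b7 → ℓ.b8 → ℓ.b10 → ℓ.b11 → ℓ.rBasicStep` (`Dag.lean` :241) read at the leaves binding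
`DagBinding.leavesP w P`; at every binding world of record `w.up P = Upstream.ofPrintedAllXPN X Y Z V W` (NODE 00, `Node00.Carriers*`)
the leaf `rBasicStep` IS `DagBinding.B15Leaf W` (`DagDischargedII.ofPrintedAllXPN_leaves`, `rfl`): the conjunction, over the bundle
`W : PrintedCarriers15`, of (0.4) `B15.Normalization04 W.D`, (0.5)–(0.6) `B15.ExpForm06 W.D W.Zpp W.ρpp W.Rsum`, Proposition 1 (1.78)
`B15.Prop1Printed W.LF`, (1.80) `B15.Ineq180 …` at every plaquette of `W.Plaq`, (1.89) `B15.BasicStep.Claim189 W.remaining W.dropped`,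
(1.102) `B15.BasicStep.Eq1102 W.Rprime W.ρk`.  The NODE 00 stages landed so far (`IsWorldOfRecord₁∕₂∕₃`) pin the B4, B5, B7 and
k-level B6 groups and leave `W` FREE per run (`Node00.Carriers2Frame.b15_main_iff_of_up₂`: at a Stage-2 run N12 ↔ `b8 → b10 → b11 →
B15Leaf W`), so N12 can only be proved at runs whose `W` is PINNED to objects (R422: a node theorem is typed over pinned carriers, never
closed over the free frame — `∀ W, B15Leaf W` is refutable: take `W.LF` with one instance, one boundary datum and no orbit).

WHAT THIS FILE DOES (the -a knit; DEFINITIONS + THEOREMS, 0 `sorry`, axioms standard).  It PINS `W` to the bundle `knitW15 κ` assembled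
from the tree's CONCRETE [Balaban1989LargeFieldI] objects over one record `κ : KnitData P k G R P₀ C ι` of Bałaban's data (the large-field
decomposition (0.2) of the k-th density, the exponents of (0.5), the Proposition-1 carrier, the lettered data of (1.89) and the
(1.100) data of 𝐑′), and proves `B15Leaf (knitW15 κ)` CONJUNCT BY CONJUNCT from the tree's kernel theorems BY NAME, displaying as
hypotheses exactly the printed statements that are not (yet) tree theorems:
* (0.2)–(0.4) p. 176 — `knitRData κ`: the abstract integration datum `B15.RData` of the b2b module `B15` instantiated over the cell's
  `Setup` vocabulary: `Vsp := GaugeField P k G`, `∫dV := ∫ · ∂fieldMeasure` (product Haar measure), regions `Z : R` with `Z ↦ Z″ := pp Z`,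
  pieces `ρ(Z, ·) := piece Z`, and the restricted integral `∫dV⌈_{Z′}` := the genuine fibre integral `B15.BasicStep.fibreIntegral (fib Z)`
  over the bond variables `fib Z` of `Z′` FOLLOWED BY `∫dV` (READING, forced by the typing of `B15.RData.IntOver` as a NUMBER — cell
  DIVERGENCE D-b01.1, recorded in `B15BasicStep`: print's `∫dV⌈_{Z′}ρ(Z, V)` is a function of `V⌈_{Z′ᶜ}`; its `∫dV`-average is the number
  the typed slot can hold; term by term both readings of (0.3) have the integral `∫dVρ(Z, V)`, which is all (0.4) asserts).
  `normalization04_knit` — **(0.4) PROVED** at this datum from the printed provisos of p. 176 (*"the densities are positive, and the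
  in[t]egration domains … nonempty, hence the denominators are positive"*): pieces measurable, nonnegative, bounded, fibre integrals of the
  denominators nowhere zero — via `B15Norm1102Object.integral_fibreIntegral` (`∫dV ∫dV⌈_{Z′} f = ∫dV f`).
* (0.5)–(0.6) p. 176 — `expForm06_of_hyp05_image`: (0.6) for ANY datum from (0.5) asserted on the regions `Z″` THAT OCCUR (the image of
  `Z ↦ Z″`; print: *"(𝐑ρ)(V) = Σ_{Z″} ρ(Z″, V) exp Σ_X 𝐑(X, V)"* sums over the second members only) — sharpening r12's
  `B15Eq06Resum.expForm06_of_hyp05`, whose hypothesis `Hyp05` on ALL regions forces `Z ↦ Z″` to be onto; the knit's `Zpp := ↥(univ.image pp)`,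
  `ρpp z := piece z`, `Rsum z := Rexp z` (the exponent `Σ_X 𝐑(X, V)` attached to `Z″`, a number in the datum — r12's recorded divergence).
  (0.5) itself (localization, polymer expansion, exponentiation: Sects. 1 ff. and [Balaban1989LargeFieldII]) is the displayed hypothesis `h05`.
* Proposition 1 (1.78) p. 194 — `LF := κ.LF`, hypothesis `hP1 : B15.Prop1Printed κ.LF` DISPLAYED (printed WITHOUT proof in [IV]; proof
  [Balaban1989LargeFieldII] pp. 358–359; tree: the p. 359 model `B16Prop1IVAssembly.prop1IV_model_of_bounds`, no inhabitation theorem of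
  `Prop1Printed` yet — seat n12-b's target).
* (1.80) p. 195 — the plaquette carrier of record := the plaquettes AT WHICH [IV] CONSUMES (1.80) in the proof of (1.89) (p. 199: *"This
  configuration is equal to U₀^{ū₀} … The plaquette variables of U₀^{ū₀} satisfy the estimate (1.80)"*, on the `j`-th ℍ-domains of
  `B15Claim189Assembly.dom`, `h ≤ j ≤ k`, for configurations in the support of the remaining functions `new189`), with the letters
  `ε_k, η, B₃, B₅, M, δ, O(1), dist(p, Λ), |U₀^{ū₀}(∂p) − 1|` of the SAME lettered record `κ.D189 : Setting189` that (1.89) reads — so ONE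
  displayed hypothesis `h180` is the leaf conjunct `i180` AND the input `L80` of p29's `claim189_assembly`.  ((1.80) is printed with its
  proof deferred, p. 195: *"We will discuss it together with the proof of Proposition 1 … we will need a stronger statement in the future"*;
  print states it *"for p ∈ Ω_k"* — the carrier records the instances the printed proof of (1.89) uses, p. 199.)
* (1.89) p. 198 — `Cfg := κ.C`, `remaining := new189 κ.D189` (print's product `χ_k(Ω_k^{∼4})χ_{k,Λ}χ_{h,1/2}χ′`), `dropped := chiPP κ.D189`
  (the CONCRETE `χ″_k`); `b15Leaf_knit_of` displays `Claim189 …` as ONE hypothesis, `b15Leaf_knit_of_leaves` UNFOLDS it through p29's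
  `B15Claim189Assembly.claim189_assembly_of_flow` into the printed per-plaquette leaves (1.90)–(1.91), (1.93)–(1.95), the p. 199 bounds,
  the [III] flow relation, the p. 200 geometry and numerics — with (1.80) supplied by `h180`.
* (1.99)–(1.102) p. 201 — `Rprime := fun _ => rPrime1100 κ.D1100` (the OBJECT 𝐑′ of (1.100), r12's `B15Sect1Statements.rPrime1100`, acting
  through the representation of record `κ.D1100 : RPrimeData`; cf. `B15Sect1Statements.eq1102_iff_normalization1102`), `ρk := κ.ρk`; the
  conjunct IS `Normalization1102 κ.D1100 κ.ρk` (`Iff.rfl`), displayed as ONE hypothesis `h1102` and discharged in the fibre model by r12's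
  `B15Norm1102Object.normalization1102_of_fibreModel` (equivalence (1.99) + localisation ∕ measurability provisos).
NODE LEVEL: `b15_main_of_up` (any run whose upstream block has the `rBasicStep` leaf), `b15_main_of_up_knit` (a run pinning `W := knitW15 κ`,
from the displayed hypotheses), `b15_main_of_pinned` (every run of a world whose runs pin `W` to bundles carrying the leaf — the shape a
NODE 00 Stage predicate delivers, cf. `Node00.Carriers3.b6_main_of_isWorldOfRecord₃_of`), and `b15Leaf_of_b15_main` (at such a run the
node RETURNS the leaf once the in-edges are inhabited — the node is exactly as strong as its pinned leaf).

HONEST FRAMING.  Bookkeeping + two elementary integrations over EXISTING kernel theorems cited by name; the analytic content of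
[Balaban1989LargeFieldI] — Proposition 1, (1.80), the leaves of (1.89), (0.5), the fibre-model provisos of (1.102) — stays DISPLAYED as
hypotheses with printed locators (a SLOT landing in the chair's sense, R429 (4)(i): count-neutral).  NOT a node discharge; the pin
`W := knitW15 κ` is this seat's PROPOSAL for the B15 group of record (NODE 00's Stage predicate is node00-def's definition to make);
typed 28∕28 · discharged 0∕28 unmoved.  One finite four-torus programme at fixed ε ([Balaban1989LargeFieldII] Thm 1 scope); NOT the
continuum limit, NOT ℝ⁴, NOT infinite volume, NOT OS, NOT a mass gap, NOT Clay.
-/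

noncomputable section

open scoped BigOperators ENNReal
open MeasureTheory

namespace Literature.MathematicalPhysics.QuantumFieldTheory.Balaban1983to89.B15LeafKnit

open DagBinding DagDischargedII
open B15 (RData Rop Normalization04 ExpForm06 Prop1Printed Ineq180)
open B15.BasicStep (fibreIntegral Claim189)
open B15Eq06Resum (quot03 quotSum rop_eq_doubleSum)
open B15Sect1Statements (RPrimeData rPrime1100 Normalization1102)
open B15Claim189Assembly (Setting189 new189 chiPP dom domK half X claim189_assembly_of_flow)
open B15Norm1102Object (integral_fibreIntegral fibreIntegral_nonneg fibreIntegral_le measurable_fibreIntegral)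
open B15.PrelimIntegrations (Ineq191 Ineq195)
open B15Chi124DetSets (E124)
open B8Eq17ClassAkV1 (plaqsOf)
open GaugeField

/-! ## §1. (0.2)–(0.4) over `Setup` at the fibre-averaged reading -/

section Sect0

variable {P : Params} {k : ℕ} {G : Type} [GaugeGroup G] [MeasurableSpace G] [HaarData G] [DecidableEq (PBond P k)]
variable {R : Type} [Fintype R]

/-- **The (0.2)–(0.4) integration datum of record over `Setup`** (p. 176, (0.2) *"ρ(V) = Σ_Z ρ(Z, V)"*, (0.3)
*"(𝐑ρ)(V) = Σ_Z ρ(Z″, V) ∫dV⌈_{Z′} ρ(Z, V) / ∫dV⌈_{Z′} ρ(Z″, V)"*): configurations `V : GaugeField P k G`, `∫dV = ∫ · ∂fieldMeasure`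
(product of the normalized Haar measures), regions `Z : R` of the large-field decomposition with `Z ↦ Z″ := pp Z` (the old part; the
region `Z` itself names its new part `Z′`, `Zp := id`), pieces `ρ(Z, ·) := piece Z`, and `∫dV⌈_{Z′} f :=` the fibre integral
`B15.BasicStep.fibreIntegral (fib Z) f` over the bond variables `fib Z` of `Z′`, averaged by `∫dV` (the typed slot `RData.IntOver` holds a
number: DIVERGENCE D-b01.1 of the cell, see the module docstring). [cite: Balaban1989LargeFieldI, (0.2)–(0.3) p.176] -/
@[reducible] def knitRData (piece : R → Density P k G) (pp : R → R) (fib : R → Finset (PBond P k)) : RData where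
  Vsp := GaugeField P k G
  Reg := R
  instF := inferInstance
  Int := fun f => ∫ V, f V ∂(fieldMeasure P k G)
  IntOver := fun Z f => ∫ V, fibreIntegral (fib Z) f V ∂(fieldMeasure P k G)
  Zp := id
  Zpp := pp
  ρ := piece

omit [DecidableEq (PBond P k)] [Fintype R] in
/-- A bounded, nonnegative, measurable density is integrable over the (probability) field measure. [folklore] -/
private theorem integrable_of_bdd {f : Density P k G} (hm : Measurable f) (h0 : ∀ V, 0 ≤ f V) {C : ℝ}
    (hC : ∀ V, f V ≤ C) : Integrable f (fieldMeasure P k G) :=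
  (integrable_const C).mono' hm.aestronglyMeasurable
    (Filter.Eventually.of_forall (fun V => by rw [Real.norm_eq_abs, abs_of_nonneg (h0 V)]; exact hC V))

omit [Fintype R] in
/-- The averaged denominator of (0.3) is POSITIVE when the fibre integral `∫dV⌈_{Z′}ρ(Z″, V)` vanishes nowhere (print's proviso,
p. 176) — for a bounded nonnegative measurable piece. [cite: Balaban1989LargeFieldI, (0.3) p.176] -/
theorem integral_fibreIntegral_pos (s : Finset (PBond P k)) {f : Density P k G} (hm : Measurable f) (h0 : ∀ V, 0 ≤ f V)
    {C : ℝ} (hC : ∀ V, f V ≤ C) (hden : ∀ V, fibreIntegral s f V ≠ 0) :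
    0 < ∫ V, fibreIntegral s f V ∂(fieldMeasure P k G) := by
  have hC0 : 0 ≤ C := (h0 (fun _ => 1)).trans (hC _)
  have hfi : Integrable (fibreIntegral s f) (fieldMeasure P k G) :=
    integrable_of_bdd (measurable_fibreIntegral s hm) (fibreIntegral_nonneg s f) (fun V => fibreIntegral_le s hC hC0 V)
  have hnn : 0 ≤ ∫ V, fibreIntegral s f V ∂(fieldMeasure P k G) := integral_nonneg (fun V => fibreIntegral_nonneg s f V)
  rcases hnn.lt_or_eq with hlt | heq
  · exact hlt
  · exfalso
    have hae := (integral_eq_zero_iff_of_nonneg (fun V => fibreIntegral_nonneg s f V) hfi).1 heq.symm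
    obtain ⟨V, hV⟩ := hae.exists
    exact hden V hV

/-- `∫dV⌈_{Z′}` of the datum, unfolded: `∫dV ∫dV⌈_{Z′} f = ∫dV f` for a bounded nonnegative measurable density (p. 193: *"the
equivalence means that both sides have equal integrals"*; r12's `integral_fibreIntegral`). [cite: Balaban1989LargeFieldI, p.193] -/
theorem intOver_knit_eq (piece : R → Density P k G) (pp : R → R) (fib : R → Finset (PBond P k)) (Z : R)
    {f : Density P k G} (hm : Measurable f) (h0 : ∀ V, 0 ≤ f V) {C : ℝ} (hC : ∀ V, f V ≤ C) :
    (knitRData piece pp fib).IntOver Z f = ∫ V, f V ∂(fieldMeasure P k G) :=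
  integral_fibreIntegral (fib Z) hm h0 hC

/-- **(0.4) PROVED at the datum of record** (p. 176, verbatim: *"It satisfies the basic normalization property ∫dV(𝐑ρ)(V) =
∫dVρ(V)."*) from the printed provisos: pieces measurable, nonnegative, uniformly bounded, and every denominator fibre integral
`∫dV⌈_{Z′}ρ(Z″, V)` nowhere zero (*"the densities are positive, and the in[t]egration domains in the integrals above are nonempty,
hence the denominators are positive"*).  Proof: term by term `ρ(Z″,·)·(∫dVρ(Z,·)/∫dVρ(Z″,·))` integrates to `∫dVρ(Z,·)`.
[cite: Balaban1989LargeFieldI, (0.4) p.176] -/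
theorem normalization04_knit (piece : R → Density P k G) (pp : R → R) (fib : R → Finset (PBond P k))
    (hm : ∀ Z, Measurable (piece Z)) (h0 : ∀ Z V, 0 ≤ piece Z V) {C : ℝ} (hC : ∀ Z V, piece Z V ≤ C)
    (hden : ∀ Z V, fibreIntegral (fib Z) (piece (pp Z)) V ≠ 0) :
    Normalization04 (knitRData piece pp fib) := by
  have hint : ∀ Z, Integrable (piece Z) (fieldMeasure P k G) := fun Z => integrable_of_bdd (hm Z) (h0 Z) (hC Z)
  have ha : ∀ Z, (∫ V, fibreIntegral (fib Z) (piece Z) V ∂(fieldMeasure P k G)) = ∫ V, piece Z V ∂(fieldMeasure P k G) :=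
    fun Z => integral_fibreIntegral (fib Z) (hm Z) (h0 Z) (hC Z)
  have hb : ∀ Z, (∫ V, fibreIntegral (fib Z) (piece (pp Z)) V ∂(fieldMeasure P k G))
      = ∫ V, piece (pp Z) V ∂(fieldMeasure P k G) :=
    fun Z => integral_fibreIntegral (fib Z) (hm _) (h0 _) (hC _)
  have hbpos : ∀ Z, 0 < ∫ V, fibreIntegral (fib Z) (piece (pp Z)) V ∂(fieldMeasure P k G) :=
    fun Z => integral_fibreIntegral_pos (fib Z) (hm _) (h0 _) (hC _) (hden Z)
  show (∫ V, Rop (knitRData piece pp fib) V ∂(fieldMeasure P k G)) = ∫ V, (∑ Z, piece Z V) ∂(fieldMeasure P k G)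
  have hterm : ∀ Z, Integrable (fun V => piece (pp Z) V *
      ((∫ U, fibreIntegral (fib Z) (piece Z) U ∂(fieldMeasure P k G)) /
        (∫ U, fibreIntegral (fib Z) (piece (pp Z)) U ∂(fieldMeasure P k G)))) (fieldMeasure P k G) :=
    fun Z => (hint (pp Z)).mul_const _
  simp only [Rop, knitRData, id]
  rw [integral_finsetSum _ (fun Z _ => hterm Z), integral_finsetSum _ (fun Z _ => hint Z)]
  refine Finset.sum_congr rfl (fun Z _ => ?_)
  have hB : (∫ V, fibreIntegral (fib Z) (piece (pp Z)) V ∂(fieldMeasure P k G)) ≠ 0 := (hbpos Z).ne'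
  rw [integral_mul_const, ha, ← hb Z]
  calc (∫ V, fibreIntegral (fib Z) (piece (pp Z)) V ∂(fieldMeasure P k G)) *
        ((∫ V, piece Z V ∂(fieldMeasure P k G)) / ∫ V, fibreIntegral (fib Z) (piece (pp Z)) V ∂(fieldMeasure P k G))
      = (∫ V, piece Z V ∂(fieldMeasure P k G)) *
        ((∫ V, fibreIntegral (fib Z) (piece (pp Z)) V ∂(fieldMeasure P k G)) /
          ∫ V, fibreIntegral (fib Z) (piece (pp Z)) V ∂(fieldMeasure P k G)) := by ring
    _ = ∫ V, piece Z V ∂(fieldMeasure P k G) := by rw [div_self hB, mul_one]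

end Sect0

/-! ## §2. (0.5) on the regions `Z″` that occur gives (0.6) — for ANY datum -/

section Sect06

variable (D : RData)

open Classical in
/-- The (0.5)-sum of a region that is nobody's `Z″` is EMPTY (hence `0`): the typed left side of (0.5) at `W` sums the
(0.3)-quotients over `{Z : Z″(Z) = W}`. [cite: Balaban1989LargeFieldI, (0.5) p.176] -/
theorem quotSum_eq_zero_of_forall_ne {W : D.Reg} (hW : ∀ Z, D.Zpp Z ≠ W) : quotSum D W = 0 := by
  unfold quotSum
  refine Finset.sum_eq_zero (fun Z hZ => ?_)
  exfalso
  exact hW Z (Finset.mem_filter.1 hZ).2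

open Classical in
/-- Why (0.5) is asserted on the OCCURRING regions only: r12's `Hyp05 D R` (the (0.5)-identity at EVERY region of the datum) forces
`Z ↦ Z″` to be ONTO — every region is then somebody's old part, which the printed combinatorics of (0.2) does not provide (a region with a
non-empty new part `Z′` is nobody's `Z″`). [cite: Balaban1989LargeFieldI, (0.5) p.176] -/
theorem zpp_surjective_of_hyp05 {Rx : D.Reg → ℝ} (h05 : B15Eq06Resum.Hyp05 D Rx) : Function.Surjective D.Zpp := by
  intro W
  by_contra hW
  have h0 : quotSum D W = 0 := quotSum_eq_zero_of_forall_ne D (fun Z hZ => hW ⟨Z, hZ⟩)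
  have h1 := h05 W
  rw [h0] at h1
  exact (Real.exp_pos (Rx W)).ne h1

variable [DecidableEq D.Reg]

/-- **(0.6) from (0.5) asserted on the regions `Z″` THAT OCCUR** (p. 176: *"Σ_{Z′⊂Z″ᶜ} ∫dV⌈_{Z′}ρ(Z′∪Z″, V) / ∫dV⌈_{Z′}ρ(Z″, V)
= exp Σ_X 𝐑(X, V), (0.5) … Using this representation, we rewrite the definition of the operation 𝐑: (𝐑ρ)(V) = Σ_{Z″} ρ(Z″, V) exp
Σ_X 𝐑(X, V). (0.6)"*): with the index type of (0.6) := the image of `Z ↦ Z″`, pieces `ρ(Z″, ·)` and exponents `Rx Z″`.  (r12's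
`expForm06_of_hyp05` is the case `Z ↦ Z″` onto.) [cite: Balaban1989LargeFieldI, (0.5)–(0.6) p.176] -/
theorem expForm06_of_hyp05_image (Rx : D.Reg → ℝ)
    (h05 : ∀ W ∈ Finset.univ.image D.Zpp, quotSum D W = Real.exp (Rx W)) :
    ExpForm06 D ↥(Finset.univ.image D.Zpp) (fun z => D.ρ z.1) (fun z _ => Rx z.1) := by
  intro V
  rw [rop_eq_doubleSum, Finset.sum_coe_sort (Finset.univ.image D.Zpp) (fun W => D.ρ W V * Real.exp (Rx W))]
  symm
  rw [Finset.sum_congr rfl (fun W hW => by rw [← h05 W hW])]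
  refine Finset.sum_subset (Finset.subset_univ _) (fun W _ hW => ?_)
  rw [quotSum_eq_zero_of_forall_ne D (fun Z hZ => hW (Finset.mem_image.2 ⟨Z, Finset.mem_univ _, hZ⟩)), mul_zero]

end Sect06

/-! ## §3. The knit record and the pinned bundle `W := knitW15 κ` -/

section Knit

variable {P : Params} {k : ℕ} {G : Type} [GaugeGroup G] [MeasurableSpace G] [HaarData G] [DecidableEq (PBond P k)]
variable {R : Type} [Fintype R] [DecidableEq R] {P₀ : Params} {C ι : Type}

/-- **The B15 data of record the knit reads** — ONE coherent record of Bałaban's [Balaban1989LargeFieldI] objects at the k-th step, over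
the lattice parameters `P`, the level `k`, the gauge group `G` (with its measurable structure and Haar datum), the index type `R` of the
large-field decompositions `Z = Z′ ∪ Z″` of (0.2), the lattice parameters `P₀`, configurations `C` and cube index `ι` of the point-set
model of (1.89): the pieces `ρ_k(Z, ·)`, `Z ↦ Z″`, the bond variables of `Z′`, the exponents `Σ_X 𝐑(X)` of (0.5) attached to each `Z″`;
the Proposition-1 carrier `LF` (p. 194); the lettered data `D189` of (1.89) (p29's `B15Claim189Assembly.Setting189`: regions `Ω_i`,
`Z″_i`, scales `h ≤ k₀ ≤ k`, the numbers `β, L₀, L, η, ε_i, α, δ, B₃, B₅, M, O(1)`, `dist(p, Λ)`, the letters `χ_k(Ω_k^{∼4})`, `χ_{k,Λ}`,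
`χ′`, the configurations `U″_{k,Z}`, `U_{h,□}`, `U₀^{ū₀}` …); the (1.100) data `D1100` of 𝐑′ (r12's `RPrimeData`) and the density `ρ_k`.
DATA only (which objects the B15 leaf is read at); nothing asserted. [cite: Balaban1989LargeFieldI, (0.2)–(0.6) p.176, Prop. 1 p.194, (1.80) p.195, (1.89) p.198, (1.99)–(1.102) pp.200–201 (dictionary)] -/
structure KnitData (P : Params) (k : ℕ) (G : Type) [GaugeGroup G] [MeasurableSpace G] [HaarData G] (R : Type) [Fintype R]
    (P₀ : Params) (C ι : Type) where
  /-- `ρ_k(Z, ·)`, the pieces of (0.2) -/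
  piece : R → Density P k G
  /-- `Z ↦ Z″` -/
  pp : R → R
  /-- the bond variables of `Z′` -/
  fib : R → Finset (PBond P k)
  /-- the exponent `Σ_X 𝐑(X)` of (0.5) attached to `Z″` -/
  Rexp : R → ℝ
  /-- the Proposition 1 carrier (p. 194) -/
  LF : B15.LFVar
  /-- the lettered data of (1.89) -/
  D189 : Setting189 P₀ G C ι
  /-- the (1.100) data of 𝐑′ -/
  D1100 : RPrimeData P k G
  /-- the density `ρ_k` -/
  ρk : Density P k G

namespace KnitData

variable (κ : KnitData P k G R P₀ C ι)

/-- The (0.2)–(0.4) datum of the record. [cite: Balaban1989LargeFieldI, (0.2)–(0.3) p.176] -/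
abbrev rdata : RData := knitRData κ.piece κ.pp κ.fib

/-- **The plaquette carrier of (1.80) of record**: the triples (configuration in the support of the remaining functions of (1.89),
level `h ≤ j ≤ k`, plaquette of the `j`-th ℍ-domain) at which the printed proof of (1.89) consumes (1.80) (p. 199: *"The plaquette
variables of U₀^{ū₀} satisfy the estimate (1.80)"*). [cite: Balaban1989LargeFieldI, (1.80) p.195, p.199] -/
def Plaq180 : Type :=
  {x : C × ℕ × Plaq P₀ 0 // new189 κ.D189 x.1 ∧ κ.D189.h ≤ x.2.1 ∧ x.2.1 ≤ κ.D189.k ∧ x.2.2 ∈ plaqsOf (dom κ.D189 x.2.1)}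

end KnitData

/-- **THE PINNED B15 BUNDLE `W := knitW15 κ`** — every field of `DagBinding.PrintedCarriers15` read at the record `κ`: `D := κ.rdata`
((0.2)–(0.4)); `Zpp := ↥(univ.image κ.pp)` (the regions `Z″` that occur), `ρpp z := ρ_k(z, ·)`, `Rsum z _ := κ.Rexp z` ((0.6));
`LF := κ.LF` (Prop. 1); the (1.80) block on `κ.Plaq180` with `dev180 := |U₀^{ū₀}(∂p) − 1|`, `distΛ := dist(p, Λ)` and the reals
`ε_k, η, B₃, B₅, M, δ, O(1)` of `κ.D189`; `Cfg := C`, `remaining := new189 κ.D189`, `dropped := chiPP κ.D189` ((1.89)); `P15, j15, G15 :=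
P, k, G`, `Rprime := fun _ => rPrime1100 κ.D1100` (𝐑′ (1.100) through the representation of record), `ρk := κ.ρk` ((1.102)).
[cite: Balaban1989LargeFieldI, (0.2)–(0.6) p.176, Prop. 1 p.194, (1.80) p.195, (1.89) p.198, (1.100)–(1.102) p.201 (dictionary)] -/
def knitW15 (κ : KnitData P k G R P₀ C ι) : PrintedCarriers15 where
  D := κ.rdata
  Zpp := ↥(Finset.univ.image κ.pp)
  instZ := inferInstance
  ρpp := fun z => κ.piece z.1
  Rsum := fun z _ => κ.Rexp z.1
  LF := κ.LF
  Plaq := κ.Plaq180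
  dev180 := fun x => κ.D189.dev0 x.1.1 x.1.2.2
  distΛ := fun x => κ.D189.dist x.1.2.2
  εk := κ.D189.ε κ.D189.k
  η := κ.D189.η
  B₃ := κ.D189.B₃
  B₅ := κ.D189.B₅
  M := κ.D189.M
  δ := κ.D189.δ
  C180 := κ.D189.O1
  Cfg := C
  remaining := new189 κ.D189
  dropped := chiPP κ.D189
  P15 := P
  j15 := k
  G15 := G
  instGG15 := inferInstance
  instMS15 := inferInstance
  instHD15 := inferInstance
  Rprime := fun _ => rPrime1100 κ.D1100
  ρk := κ.ρk

/-! ## §4. The leaf `B15Leaf (knitW15 κ)` conjunct by conjunct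

The DISPLAYED printed statements are written out as hypotheses (no `def … : Prop`): `h02` = the (0.2) provisos of p. 176 on the pieces
(*"the densities are positive, and the in[t]egration domains … nonempty, hence the denominators are positive"*: measurable, nonnegative,
uniformly bounded pieces; denominator fibre integrals nowhere zero); `h05` = (0.5) on the regions `Z″` that occur; `hP1` = Proposition 1
(1.78); `h180` = (1.80) on the ℍ-domains of (1.89), per plaquette, with the letters of `κ.D189` — verbatim the input `L80` of p29's
`claim189_assembly`; `h189` = (1.89); `h1102` = (1.102) for the object 𝐑′. -/

variable (κ : KnitData P k G R P₀ C ι)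

/-- The (1.80) conjunct of the pinned bundle IS (1.80) on the ℍ-domains of (1.89) (`Iff` by currying). [cite: Balaban1989LargeFieldI, (1.80) p.195] -/
theorem i180_knit_iff :
    (∀ p : (knitW15 κ).Plaq, Ineq180 ((knitW15 κ).dev180 p) (knitW15 κ).εk (knitW15 κ).η (knitW15 κ).B₃ (knitW15 κ).B₅
      (knitW15 κ).M (knitW15 κ).δ ((knitW15 κ).distΛ p) (knitW15 κ).C180) ↔
    ∀ U, new189 κ.D189 U → ∀ j, κ.D189.h ≤ j → j ≤ κ.D189.k → ∀ p ∈ plaqsOf (dom κ.D189 j),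
      Ineq180 (κ.D189.dev0 U p) (κ.D189.ε κ.D189.k) κ.D189.η κ.D189.B₃ κ.D189.B₅ κ.D189.M κ.D189.δ (κ.D189.dist p) κ.D189.O1 := by
  constructor
  · intro h U hU j hj hjk p hp
    exact h ⟨(U, j, p), hU, hj, hjk, hp⟩
  · rintro h ⟨⟨U, j, p⟩, hU, hj, hjk, hp⟩
    exact h U hU j hj hjk p hp

/-- The (1.102) conjunct of the pinned bundle IS `Normalization1102 κ.D1100 κ.ρk` — (1.102) for the object 𝐑′ of (1.100)
(r12's `eq1102_iff_normalization1102`, `Iff.rfl`). [cite: Balaban1989LargeFieldI, (1.102) p.201] -/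
theorem e1102_knit_iff :
    B15.BasicStep.Eq1102 (knitW15 κ).Rprime (knitW15 κ).ρk ↔ Normalization1102 κ.D1100 κ.ρk := Iff.rfl

/-- The (1.89) conjunct of the pinned bundle IS `Claim189 (new189 κ.D189) (chiPP κ.D189)` (`Iff.rfl`). [cite: Balaban1989LargeFieldI, (1.89) p.198] -/
theorem c189_knit_iff :
    Claim189 (knitW15 κ).remaining (knitW15 κ).dropped ↔ Claim189 (new189 κ.D189) (chiPP κ.D189) := Iff.rfl

/-- **(0.4) for the pinned bundle** from the (0.2) provisos of p. 176. [cite: Balaban1989LargeFieldI, (0.4) p.176] -/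
theorem n04_knit (hm : ∀ Z, Measurable (κ.piece Z)) (h0 : ∀ Z V, 0 ≤ κ.piece Z V) {Cρ : ℝ} (hC : ∀ Z V, κ.piece Z V ≤ Cρ)
    (hden : ∀ Z V, fibreIntegral (κ.fib Z) (κ.piece (κ.pp Z)) V ≠ 0) : Normalization04 (knitW15 κ).D :=
  normalization04_knit κ.piece κ.pp κ.fib hm h0 hC hden

/-- **(0.6) for the pinned bundle** from (0.5) on the regions that occur. [cite: Balaban1989LargeFieldI, (0.6) p.176] -/
theorem e06_knit (h05 : ∀ W ∈ Finset.univ.image κ.pp, quotSum κ.rdata W = Real.exp (κ.Rexp W)) :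
    ExpForm06 (knitW15 κ).D (knitW15 κ).Zpp (knitW15 κ).ρpp (knitW15 κ).Rsum :=
  expForm06_of_hyp05_image κ.rdata κ.Rexp h05

/-- **THE B15 LEAF AT THE PINNED BUNDLE, KNITTED BY NAME** — `DagBinding.B15Leaf (knitW15 κ)` from: the (0.2) provisos and (0.5) on the
occurring regions ((0.4), (0.6) PROVED: `normalization04_knit`, `expForm06_of_hyp05_image`); Proposition 1 (1.78) DISPLAYED (`hP1`);
(1.80) on the ℍ-domains DISPLAYED (`h180`); (1.89) as ONE displayed hypothesis (`h189`; unfolded to the printed leaves in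
`b15Leaf_knit_of_leaves`); (1.102) for the object 𝐑′ as ONE displayed hypothesis (`h1102`; discharged in the fibre model by r12's
`B15Norm1102Object.normalization1102_of_fibreModel`). [cite: Balaban1989LargeFieldI, Prop. 1 (1.78) p.194, (0.4)–(0.6) p.176, (1.80) p.195, (1.89) p.198, (1.102) p.201] -/
theorem b15Leaf_knit_of (hm : ∀ Z, Measurable (κ.piece Z)) (h0 : ∀ Z V, 0 ≤ κ.piece Z V) {Cρ : ℝ} (hC : ∀ Z V, κ.piece Z V ≤ Cρ)
    (hden : ∀ Z V, fibreIntegral (κ.fib Z) (κ.piece (κ.pp Z)) V ≠ 0)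
    (h05 : ∀ W ∈ Finset.univ.image κ.pp, quotSum κ.rdata W = Real.exp (κ.Rexp W))
    (hP1 : Prop1Printed κ.LF)
    (h180 : ∀ U, new189 κ.D189 U → ∀ j, κ.D189.h ≤ j → j ≤ κ.D189.k → ∀ p ∈ plaqsOf (dom κ.D189 j),
      Ineq180 (κ.D189.dev0 U p) (κ.D189.ε κ.D189.k) κ.D189.η κ.D189.B₃ κ.D189.B₅ κ.D189.M κ.D189.δ (κ.D189.dist p) κ.D189.O1)
    (h189 : Claim189 (new189 κ.D189) (chiPP κ.D189)) (h1102 : Normalization1102 κ.D1100 κ.ρk) :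
    B15Leaf (knitW15 κ) where
  n04 := n04_knit κ hm h0 hC hden
  e06 := e06_knit κ h05
  p1 := hP1
  i180 := (i180_knit_iff κ).2 h180
  c189 := h189
  e1102 := h1102

/-- Conversely the pinned leaf RETURNS the displayed statements (nothing is hidden in the pin): Proposition 1, (1.80) on the
ℍ-domains, (1.89), (1.102). [cite: Balaban1989LargeFieldI, Prop. 1 (1.78) p.194] -/
theorem slots_of_b15Leaf_knit (h : B15Leaf (knitW15 κ)) :
    Prop1Printed κ.LF ∧
    (∀ U, new189 κ.D189 U → ∀ j, κ.D189.h ≤ j → j ≤ κ.D189.k → ∀ p ∈ plaqsOf (dom κ.D189 j),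
      Ineq180 (κ.D189.dev0 U p) (κ.D189.ε κ.D189.k) κ.D189.η κ.D189.B₃ κ.D189.B₅ κ.D189.M κ.D189.δ (κ.D189.dist p) κ.D189.O1) ∧
    Claim189 (new189 κ.D189) (chiPP κ.D189) ∧ Normalization1102 κ.D1100 κ.ρk :=
  ⟨h.p1, (i180_knit_iff κ).1 h.i180, h.c189, h.e1102⟩

/-- **THE B15 LEAF AT THE PINNED BUNDLE WITH (1.89) UNFOLDED TO ITS PRINTED LEAVES** (p29's `claim189_assembly_of_flow`, every hypothesis
carried verbatim with its locator; its input `L80` = (1.80) is the displayed `h180`, shared with the leaf's own (1.80) conjunct): levels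
`h ≤ k₀`, `k₀ + 2 ≤ k`; nested `Ω`'s (`Ω_{k+1} := Ω_k` at the top); numerics `α = 1/12` (p. 199), `0 ≤ β ≤ 1/4` (p. 198), `2 ≤ L₀`,
`L₀² ≤ L` (p. 191), `0 ≤ ε_i ≤ 1/10`, `O(1)B₃B₅M⁵ ≥ 0`, `δ, M ≥ 0`, `dist(p, Λ) ≥ 0`; p. 200 *"with an increased O(1)"*, *"if
O(1)B₃B₅M⁵L₀^{−2(N₀−1)} ≤ 1/4"*, *"We have j = k"*, the shell geometry `4(m − k₀)M ≤ dist(p, Λ)` and the choice of `M`; the [III] (2.8)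
flow relation; the cube cover of (1.88); the leaves (1.90)–(1.91) and (1.93)–(1.95) on the half domain, the two (1.91)-type bounds of
p. 199 on the ℍ-domains. [cite: Balaban1989LargeFieldI, (1.89) p.198, pp.199–200] -/
theorem b15Leaf_knit_of_leaves (hm : ∀ Z, Measurable (κ.piece Z)) (h0 : ∀ Z V, 0 ≤ κ.piece Z V) {Cρ : ℝ}
    (hC : ∀ Z V, κ.piece Z V ≤ Cρ) (hden : ∀ Z V, fibreIntegral (κ.fib Z) (κ.piece (κ.pp Z)) V ≠ 0)
    (h05 : ∀ W ∈ Finset.univ.image κ.pp, quotSum κ.rdata W = Real.exp (κ.Rexp W)) (hP1 : Prop1Printed κ.LF)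
    (h180 : ∀ U, new189 κ.D189 U → ∀ j, κ.D189.h ≤ j → j ≤ κ.D189.k → ∀ p ∈ plaqsOf (dom κ.D189 j),
      Ineq180 (κ.D189.dev0 U p) (κ.D189.ε κ.D189.k) κ.D189.η κ.D189.B₃ κ.D189.B₅ κ.D189.M κ.D189.δ (κ.D189.dist p) κ.D189.O1)
    (h1102 : Normalization1102 κ.D1100 κ.ρk)
    -- the hypotheses of `claim189_assembly_of_flow` except `L80`
    (hhk : κ.D189.h ≤ κ.D189.k₀) (hk : κ.D189.k₀ + 2 ≤ κ.D189.k)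
    (hΩ : ∀ i, (κ.D189.Ω (i + 1) : Set (Site P₀ 0)) ⊆ κ.D189.Ω i)
    (hΩtop : (κ.D189.Ω κ.D189.k : Set (Site P₀ 0)) ⊆ κ.D189.Ω (κ.D189.k + 1))
    (hα : κ.D189.α = 1 / 12) (hβ0 : 0 ≤ κ.D189.β) (hβ : κ.D189.β ≤ 1 / 4) (hL₀ : 2 ≤ κ.D189.L₀)
    (hL₀L : κ.D189.L₀ ^ 2 ≤ κ.D189.L) (hε0 : ∀ i, 0 ≤ κ.D189.ε i) (hε1 : ∀ i, κ.D189.ε i ≤ 1 / 10)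
    (hB : 0 ≤ κ.D189.O1 * κ.D189.B₃ * κ.D189.B₅ * κ.D189.M ^ 5) (hδ : 0 ≤ κ.D189.δ) (hM : 0 ≤ κ.D189.M)
    (hdist : ∀ p, 0 ≤ κ.D189.dist p)
    {X' : ℝ} (hX' : ∀ j, 2 + X κ.D189 j ≤ X') (hsmall : X' * ((κ.D189.L₀ ^ 2) ^ (κ.D189.k - κ.D189.k₀ - 1))⁻¹ ≤ 1 / 4)
    (hjEqK : ∀ m, κ.D189.k₀ < m → m < κ.D189.k → (κ.D189.Ω m \ κ.D189.Ω (m + 1) : Set (Site P₀ 0)) ⊆ domK κ.D189)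
    (hgeom : ∀ m, κ.D189.k₀ < m → m < κ.D189.k → ∀ p ∈ plaqsOf (κ.D189.Ω m \ κ.D189.Ω (m + 1)),
      4 * ((m : ℝ) - κ.D189.k₀) * κ.D189.M ≤ κ.D189.dist p)
    (hlarge : X κ.D189 κ.D189.k * Real.exp (-(4 * κ.D189.δ * κ.D189.M)) ≤ κ.D189.α)
    {β₀ : ℝ} (hβ₀0 : 0 ≤ β₀) (hβ₀ : β₀ ≤ 1 / 2)
    (hflow : ∀ j, κ.D189.h ≤ j → j < κ.D189.k →
      κ.D189.ε κ.D189.k ≤ (1 + β₀) * Real.sqrt ((κ.D189.k - j : ℕ) : ℝ) * κ.D189.ε j)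
    (hbox : ∀ p ∈ plaqsOf (half κ.D189), κ.D189.boxOf p ∈ κ.D189.halfcubes ∧ p ∈ κ.D189.plaqT (κ.D189.boxOf p))
    (L91h : ∀ U, new189 κ.D189 U → ∀ p ∈ plaqsOf (half κ.D189),
      Ineq191 (dist1 (plaqHol (κ.D189.Upp U) p)) (κ.D189.devV'' U p) κ.D189.α ((κ.D189.L ^ κ.D189.h)⁻¹) (κ.D189.ε κ.D189.h)
        (E124 κ.D189.ε κ.D189.L κ.D189.η κ.D189.k κ.D189.h))
    (L95 : ∀ U, new189 κ.D189 U → ∀ p ∈ plaqsOf (half κ.D189),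
      Ineq195 (κ.D189.devV'' U p) (dist1 (plaqHol (κ.D189.Uhalf U (κ.D189.boxOf p)) p)) κ.D189.α ((κ.D189.L ^ κ.D189.h)⁻¹)
        (κ.D189.ε κ.D189.h) (E124 κ.D189.ε κ.D189.L κ.D189.η κ.D189.k κ.D189.h))
    (L91 : ∀ U, new189 κ.D189 U → ∀ j, κ.D189.h ≤ j → j ≤ κ.D189.k → ∀ p ∈ plaqsOf (dom κ.D189 j),
      Ineq191 (dist1 (plaqHol (κ.D189.Upp U) p)) (κ.D189.dev97 U p) κ.D189.α ((κ.D189.L ^ j)⁻¹) (κ.D189.ε j)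
        (E124 κ.D189.ε κ.D189.L κ.D189.η κ.D189.k j))
    (L97 : ∀ U, new189 κ.D189 U → ∀ j, κ.D189.h ≤ j → j ≤ κ.D189.k → ∀ p ∈ plaqsOf (dom κ.D189 j),
      Ineq191 (κ.D189.dev97 U p) (κ.D189.dev0 U p) κ.D189.α ((κ.D189.L ^ j)⁻¹) (κ.D189.ε j)
        (E124 κ.D189.ε κ.D189.L κ.D189.η κ.D189.k j)) :
    B15Leaf (knitW15 κ) :=
  b15Leaf_knit_of κ hm h0 hC hden h05 hP1 h180
    (claim189_assembly_of_flow κ.D189 hhk hk hΩ hΩtop hα hβ0 hβ hL₀ hL₀L hε0 hε1 hB hδ hM hdist hX' hsmall hjEqK hgeom hlarge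
      hβ₀0 hβ₀ hflow hbox L91h L95 L91 L97 h180)
    h1102

end Knit

/-! ## §5. The DAG node N12 at runs pinning `W` -/

section Node

/-- **N12 at a run whose upstream block carries the `rBasicStep` leaf**: `Dag.B15_main (leavesP w P)` (the antecedents `b5 b7 b8 b10 b11`
are not used). [cite: Balaban1989LargeFieldI, Prop. 1 p.194 (the node of `Dag.lean`, bookkeeping)] -/
theorem b15_main_of_up {w : WorldP} {P : B12.RunParams} {U : Upstream} (hP : w.up P = U) (h : U.rBasicStep) :
    Dag.B15_main (leavesP w P) := by
  intro _ _ _ _ _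
  show (w.up P).rBasicStep
  rw [hP]
  exact h

/-- At a run bound by the N-binding over ANY bundles, N12 follows from the B15 leaf of the run's `W` (`rBasicStep = B15Leaf W`, `rfl`).
[cite: Balaban1989LargeFieldI, Prop. 1 p.194 (bookkeeping)] -/
theorem b15_main_of_up_of_leaf {w : WorldP} {P : B12.RunParams} {X : PrintedCarriersR} {Y : PrintedCarriers9X}
    {Z : PrintedCarriers11} {V : PrintedCarriers14R} {W : PrintedCarriers15}
    (hP : w.up P = Upstream.ofPrintedAllXPN X Y Z V W) (h : B15Leaf W) : Dag.B15_main (leavesP w P) :=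
  b15_main_of_up hP h

/-- **N12 AT EVERY RUN OF A WORLD WHOSE RUNS PIN `W` TO BUNDLES CARRYING THE LEAF** (the B15 group is run-indexed: the k-th density, its
regions, the step's lettered data) — the shape a NODE 00 stage predicate delivers (cf. `Node00.Carriers3.b6_main_of_isWorldOfRecord₃_of`).
[cite: Balaban1989LargeFieldI, Prop. 1 p.194 (bookkeeping)] -/
theorem b15_main_of_pinned (w : WorldP)
    (hw : ∀ P : B12.RunParams, ∃ (X : PrintedCarriersR) (Y : PrintedCarriers9X) (Z : PrintedCarriers11) (V : PrintedCarriers14R)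
      (W : PrintedCarriers15), w.up P = Upstream.ofPrintedAllXPN X Y Z V W ∧ B15Leaf W)
    (P : B12.RunParams) : Dag.B15_main (leavesP w P) := by
  obtain ⟨X, Y, Z, V, W, hP, hW⟩ := hw P
  exact b15_main_of_up hP hW

/-- … and conversely, at a run bound by the N-binding, N12 together with the in-edges `b5 b7 b8 b10 b11` of the run RETURNS the leaf of
its `W` — the node is exactly as strong as its leaf at the pin (no vacuity through the antecedents once they are inhabited).
[cite: Balaban1989LargeFieldI, Prop. 1 p.194 (bookkeeping)] -/
theorem b15Leaf_of_b15_main {w : WorldP} {P : B12.RunParams} {X : PrintedCarriersR} {Y : PrintedCarriers9X}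
    {Z : PrintedCarriers11} {V : PrintedCarriers14R} {W : PrintedCarriers15}
    (hP : w.up P = Upstream.ofPrintedAllXPN X Y Z V W) (h : Dag.B15_main (leavesP w P))
    (h5 : (Upstream.ofPrintedAllXPN X Y Z V W).b5) (h7 : (Upstream.ofPrintedAllXPN X Y Z V W).b7)
    (h8 : (Upstream.ofPrintedAllXPN X Y Z V W).b8) (h10 : (Upstream.ofPrintedAllXPN X Y Z V W).b10)
    (h11 : (Upstream.ofPrintedAllXPN X Y Z V W).b11) : B15Leaf W := by
  have h' : (w.up P).b5 → (w.up P).b7 → (w.up P).b8 → (w.up P).b10 → (w.up P).b11 → (w.up P).rBasicStep := h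
  rw [hP] at h'
  exact h' h5 h7 h8 h10 h11

variable {P : Params} {k : ℕ} {G : Type} [GaugeGroup G] [MeasurableSpace G] [HaarData G] [DecidableEq (PBond P k)]
variable {R : Type} [Fintype R] [DecidableEq R] {P₀ : Params} {C ι : Type}

/-- **N12 · [Balaban1989LargeFieldI] AT A RUN PINNING `W := knitW15 κ`**, from the displayed printed statements (Prop. 1, (1.80), (1.89),
(1.102)) and the knit's provisos ((0.2), (0.5)). [cite: Balaban1989LargeFieldI, Prop. 1 (1.78) p.194, (0.4)–(0.6) p.176, (1.80) p.195, (1.89) p.198, (1.102) p.201] -/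
theorem b15_main_of_up_knit (κ : KnitData P k G R P₀ C ι) {w : WorldP} {Pr : B12.RunParams} {X : PrintedCarriersR}
    {Y : PrintedCarriers9X} {Z : PrintedCarriers11} {V : PrintedCarriers14R}
    (hP : w.up Pr = Upstream.ofPrintedAllXPN X Y Z V (knitW15 κ))
    (hm : ∀ Z, Measurable (κ.piece Z)) (h0 : ∀ Z V, 0 ≤ κ.piece Z V) {Cρ : ℝ} (hC : ∀ Z V, κ.piece Z V ≤ Cρ)
    (hden : ∀ Z V, fibreIntegral (κ.fib Z) (κ.piece (κ.pp Z)) V ≠ 0)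
    (h05 : ∀ W ∈ Finset.univ.image κ.pp, quotSum κ.rdata W = Real.exp (κ.Rexp W))
    (hP1 : Prop1Printed κ.LF)
    (h180 : ∀ U, new189 κ.D189 U → ∀ j, κ.D189.h ≤ j → j ≤ κ.D189.k → ∀ p ∈ plaqsOf (dom κ.D189 j),
      Ineq180 (κ.D189.dev0 U p) (κ.D189.ε κ.D189.k) κ.D189.η κ.D189.B₃ κ.D189.B₅ κ.D189.M κ.D189.δ (κ.D189.dist p) κ.D189.O1)
    (h189 : Claim189 (new189 κ.D189) (chiPP κ.D189)) (h1102 : Normalization1102 κ.D1100 κ.ρk) :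
    Dag.B15_main (leavesP w Pr) :=
  b15_main_of_up hP (b15Leaf_knit_of κ hm h0 hC hden h05 hP1 h180 h189 h1102)

end Node

end Literature.MathematicalPhysics.QuantumFieldTheory.Balaban1983to89.B15LeafKnit

end
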